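import Mathlib
import HarnessLib
import Literature.MathematicalPhysics.StatisticalMechanics.PolymerClosureGain
import Literature.MathematicalPhysics.StatisticalMechanics.ReblockingNeighbourhoods

/-!
# Counting for the reblocking step: `|𝓑_k(U)| = L^d |U|_{k+1}`, blocks near a point, small
# polymers through a block, and the animal sums `Σ_{X̄ = U} κ^{|X|_k}` ([ABKM19] App. A,
# proof of Lemma 10.2; Brydges 2009, Lemmas 6.16, 6.18)

The large-polymer part `F(U) = Σ_{X ∈ 𝒫_k^c∖ℬ_k, π(X)=U} ∫ K(X, · + ξ) dμ_{k+1}` of the linearised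
map `C^{(q)}` ([ABKM19] (6.58), Lemma 10.2) is controlled by two counting facts:

* **Lemma A.2 / [Bry09] Lemma 6.16** — `Σ_{X : X̄ = U} κ^{|X|_k} ≤ (2^{L^d} κ)^{|U|_{k+1}} (≤ 1)`:
  proved here (`sum_pow_card_blocks_le`, `sum_pow_card_blocks_le_one`) for ALL `k`-polymers
  `X ⊆ U` with `X̄ = U`, from `|X̄|_{k+1} ≤ |X|_k` (`card_blocks_closure_le`) and the count
  `#{X ⊆ U} ≤ 2^{|𝓑_k(U)|} = 2^{L^d |U|_{k+1}}` (`card_polys_le_two_pow`, `card_blocks_eq_mul`);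
  the form with the gain `A^{|U|_{k+1} − |X|_k} ≤ A^{−(η−1)|U|_{k+1}}` used in (10.8) is
  `sum_gain_le` (the gain `η|U|_{k+1} ≤ |X|_k` enters as a hypothesis, cf. `BrydgesClosureGain`);
* **the number of small polymers meeting a `(k+1)`-block** is at most `L^d · c(d)`,
  `c(d) = 2^{(2^{d+1}+2)^d}` (`card_small_meeting_block_le`; [ABKM19] p. 83: "there are `L^d`
  possibilities to pick the first block … all further blocks are contained in a cube").

Auxiliary: `card_blocks_eq_numBlocks` (`|𝓑_k(X)| = |X|_k`), `numBlocks_eq_mul` /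
`card_blocks_eq_mul` (`|𝓑_k(U)| = L^d |U|_{k+1}` for a `(k+1)`-polymer `U`),
`card_blocks_le_of_subset_ball` (a set within sup-distance `R` of a point meets at most
`(2⌊R/s⌋ + 4)^d` blocks — volume count).  Everything here is proved.

## References
* S. Adams, S. Buchholz, R. Kotecký, S. Müller, arXiv:1910.13564, App. A and the proof of
  Lemma 10.2 [AdamsBuchholzKoteckyMuller2019].
* D. C. Brydges, *Lectures on the renormalisation group*, IAS/Park City Math. Ser. 16 (2009),
  Lemmas 6.16, 6.18 [Brydges2009].
-/

noncomputable section

namespace Literature.MathematicalPhysics.StatisticalMechanics.TorusPolymer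

open scoped BigOperators Classical
open Finset
open Literature.Barriers.CriticalPhenomena.LongRangePhi4.Polymer (IsConn)

variable {d M : ℕ} [NeZero M]

/-! ## `|𝓑_k(X)| = |X|_k` -/

/-- **`|𝓑_k(X)| = |X|_k`**: the number of blocks met equals the number of block indices met.
[cite: AdamsBuchholzKoteckyMuller2019, Ch. 6.2] -/
theorem card_blocks_eq_numBlocks (s : ℕ) (X : Finset (Fin d → ZMod M)) :
    (blocks s X).card = numBlocks s X := by
  rw [blocks, numBlocks]
  have h : X.image (blockOf s) = (X.image fun y => fun i => cubeIndex s y i).image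
      fun b => univ.filter fun y => (fun i => cubeIndex s y i) = b := by
    rw [Finset.image_image]
    refine Finset.image_congr fun x _ => ?_
    simp only [Function.comp_apply, blockOf_eq_filter_cubeIndex]
  rw [h]
  refine Finset.card_image_of_injOn fun b₁ hb₁ b₂ _ heq => ?_
  obtain ⟨x, -, rfl⟩ := mem_image.1 (Finset.mem_coe.1 hb₁)
  have hx : x ∈ univ.filter fun y => (fun i => cubeIndex s y i) = fun i => cubeIndex s x i :=
    mem_filter.2 ⟨mem_univ _, rfl⟩
  rw [heq] at hx
  exact (mem_filter.1 hx).2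

/-! ## `k`-blocks inside `(k+1)`-polymers: `|U|_k = L^d |U|_{k+1}` -/

/-- **`|U|_k = L^d |U|_{k+1}`** for a `(k+1)`-polymer `U` (odd sides `s`, `L`, `M = L·s·t`):
counting points, `|U| = |U|_{k+1} (Ls)^d = |U|_k s^d`. [cite: AdamsBuchholzKoteckyMuller2019, Ch. 6.2] -/
theorem numBlocks_eq_mul {s L t : ℕ} (hM : M = L * s * t) (hs : Odd s) (hL : Odd L) (ht : Odd t)
    {U : Finset (Fin d → ZMod M)} (hU : IsPolymer (L * s) U) :
    numBlocks s U = L ^ d * numBlocks (L * s) U := by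
  have h1 : U.card = numBlocks (L * s) U * (L * s) ^ d :=
    card_eq_numBlocks_mul (by rw [hM]) (hL.mul hs) ht hU
  have h2 : U.card = numBlocks s U * s ^ d :=
    card_eq_numBlocks_mul (by rw [hM]; ring) hs (hL.mul ht) (hU.of_mul hs hL)
  have hs0 : 0 < s ^ d := pow_pos hs.pos d
  rw [h2, mul_pow, ← mul_assoc, mul_comm (numBlocks (L * s) U)] at h1
  exact Nat.eq_of_mul_eq_mul_right hs0 h1

/-- **`|𝓑_k(U)| = L^d |𝓑_{k+1}(U)|`** for a `(k+1)`-polymer `U`. [cite: AdamsBuchholzKoteckyMuller2019, Ch. 6.2] -/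
theorem card_blocks_eq_mul {s L t : ℕ} (hM : M = L * s * t) (hs : Odd s) (hL : Odd L) (ht : Odd t)
    {U : Finset (Fin d → ZMod M)} (hU : IsPolymer (L * s) U) :
    (blocks s U).card = L ^ d * (blocks (L * s) U).card := by
  rw [card_blocks_eq_numBlocks, card_blocks_eq_numBlocks, numBlocks_eq_mul hM hs hL ht hU]

/-- A `(k+1)`-block is met by exactly one `(k+1)`-block. [cite: AdamsBuchholzKoteckyMuller2019, Ch. 6.2] -/
theorem blocks_blockOf (s' : ℕ) (y : Fin d → ZMod M) : blocks s' (blockOf s' y) = {blockOf s' y} := by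
  ext B
  rw [mem_blocks, mem_singleton]
  constructor
  · rintro ⟨z, hz, rfl⟩; exact blockOf_eq_of_mem hz
  · rintro rfl; exact ⟨y, mem_blockOf_self s' y, rfl⟩

/-- **A `(k+1)`-block consists of `L^d` `k`-blocks.** [cite: AdamsBuchholzKoteckyMuller2019, Ch. 6.2] -/
theorem card_blocks_blockOf_mul {s L t : ℕ} (hM : M = L * s * t) (hs : Odd s) (hL : Odd L) (ht : Odd t)
    (y : Fin d → ZMod M) : (blocks s (blockOf (L * s) y)).card = L ^ d := by
  rw [card_blocks_eq_mul hM hs hL ht (isPolymer_blockOf _ y), blocks_blockOf, card_singleton, mul_one]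

/-! ## Blocks near a point (volume count) -/

/-- `|𝓑_k(Y)| · s^d ≤ |closure_k Y|`: the blocks met by `Y` are disjoint `s^d`-point subsets of the
`k`-closure of `Y`. [cite: AdamsBuchholzKoteckyMuller2019, Ch. 6.2] -/
theorem card_blocks_mul_le_card_closure {s t : ℕ} (hM : M = s * t) (hs : Odd s) (ht : Odd t)
    (Y : Finset (Fin d → ZMod M)) : (blocks s Y).card * s ^ d ≤ (closure s Y).card := by
  rw [card_eq_numBlocks_mul hM hs ht (isPolymer_closure s Y), ← card_blocks_eq_numBlocks]
  exact Nat.mul_le_mul_right _ (card_le_card (blocks_mono s (subset_closure s Y)))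

/-- The `k`-closure of a set within sup-distance `R` of `c` lies within `R + (s − 1)` of `c`.
[cite: AdamsBuchholzKoteckyMuller2019, Ch. 6.2] -/
theorem closure_subset_ball {s R : ℕ} (hs : Odd s) {Y : Finset (Fin d → ZMod M)} {c : Fin d → ZMod M}
    (hY : ∀ y ∈ Y, GradientFRD.supNorm (y - c) ≤ R) : closure s Y ⊆ ball (R + (s - 1)) c := by
  intro z hz
  obtain ⟨y, hy, hyz⟩ := mem_closure.1 hz
  rw [mem_ball]
  have h1 : GradientFRD.supNorm (z - y) ≤ s - 1 := supNorm_sub_le_of_sameBlock hs hyz.symm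
  have h2 := supNorm_sub_le z y c
  have h3 := hY y hy
  omega

/-- **A set within sup-distance `R` of a point meets at most `(2⌊R/s⌋ + 4)^d` blocks of side `s`**
(volume count: the blocks met lie in the cube of radius `R + s − 1`, each has `s^d` points).
[cite: AdamsBuchholzKoteckyMuller2019, proof of Lemma 10.2] -/
theorem card_blocks_le_of_subset_ball {s t R : ℕ} (hM : M = s * t) (hs : Odd s) (ht : Odd t)
    {Y : Finset (Fin d → ZMod M)} {c : Fin d → ZMod M} (hY : ∀ y ∈ Y, GradientFRD.supNorm (y - c) ≤ R) :
    (blocks s Y).card ≤ (2 * (R / s) + 4) ^ d := by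
  have h1 : (blocks s Y).card * s ^ d ≤ (2 * (R + (s - 1)) + 1) ^ d :=
    (card_blocks_mul_le_card_closure hM hs ht Y).trans
      ((card_le_card (closure_subset_ball hs hY)).trans (card_ball_le _ _))
  have hs0 : 0 < s := hs.pos
  have h2 : 2 * (R + (s - 1)) + 1 ≤ (2 * (R / s) + 4) * s := by
    have hdm := Nat.div_add_mod R s
    have hml := Nat.mod_lt R hs0
    set q := R / s
    set r := R % s
    obtain ⟨P, hP⟩ : ∃ P, P = s * q := ⟨_, rfl⟩
    have e : (2 * q + 4) * s = 2 * P + 4 * s := by rw [hP]; ring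
    rw [← hP] at hdm
    omega
  have h3 : (blocks s Y).card * s ^ d ≤ (2 * (R / s) + 4) ^ d * s ^ d := by
    rw [← mul_pow]
    exact h1.trans (Nat.pow_le_pow_left h2 d)
  exact Nat.le_of_mul_le_mul_right h3 (pow_pos hs0 d)

/-! ## Small polymers through a block -/

/-- The small connected `k`-polymers containing a point `x` lie in the cube `x + [−(2^d s − 1), 2^d s − 1]^d`,
so there are at most `c(d) = 2^{(2^{d+1}+2)^d}` of them. [cite: AdamsBuchholzKoteckyMuller2019, proof of Lemma 10.2] -/
theorem card_small_containing_le {s t : ℕ} (hM : M = s * t) (hs : Odd s) (ht : Odd t)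
    (x : Fin d → ZMod M) :
    ((polys s univ).filter fun X => IsConn X ∧ (blocks s X).card ≤ 2 ^ d ∧ x ∈ X).card
      ≤ 2 ^ ((2 ^ (d + 1) + 2) ^ d) := by
  set R := (2 ^ d - 1) * s + (s - 1) with hR
  -- every such polymer lies in the ball of radius `R` about `x`
  have hsub : ((polys s univ).filter fun X => IsConn X ∧ (blocks s X).card ≤ 2 ^ d ∧ x ∈ X)
      ⊆ polys s (ball R x) := by
    intro X hX
    obtain ⟨hXp, hc, hm, hx⟩ := mem_filter.1 hX
    have hP := (mem_polys.1 hXp).2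
    refine mem_polys.2 ⟨?_, hP⟩
    exact (subset_thicken_blockOf_of_isConn hM hs ht hc hm hx).trans (thicken_blockOf_subset_ball hs _ x)
  refine (card_le_card hsub).trans ((card_polys_le_two_pow s _).trans ?_)
  apply Nat.pow_le_pow_right (by norm_num)
  -- the ball meets at most `(2⌊R/s⌋ + 4)^d ≤ (2^{d+1} + 2)^d` blocks
  refine (card_blocks_le_of_subset_ball hM hs ht (R := R) fun y hy => mem_ball.1 hy).trans ?_
  apply Nat.pow_le_pow_left
  have hs0 : 0 < s := hs.pos
  have hRs : R / s < 2 ^ d := by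
    rw [Nat.div_lt_iff_lt_mul hs0, hR]
    have h1 : 1 ≤ 2 ^ d := Nat.one_le_two_pow
    have : (2 ^ d - 1) * s + s = 2 ^ d * s := by
      rw [Nat.sub_mul, one_mul, Nat.sub_add_cancel (Nat.le_mul_of_pos_left s (by omega) |>.trans_eq'
        (by ring))]
    omega
  have : 2 ^ (d + 1) = 2 * 2 ^ d := by ring
  omega

/-- **At most `L^d · c(d)` small connected `k`-polymers meet a given `(k+1)`-block**
(`c(d) = 2^{(2^{d+1}+2)^d}`): `L^d` choices of a `k`-block of `B'` inside the polymer, then at most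
`c(d)` small polymers through it. [cite: AdamsBuchholzKoteckyMuller2019, proof of Lemma 10.2] -/
theorem card_small_meeting_block_le {s L t : ℕ} (hM : M = L * s * t) (hs : Odd s) (hL : Odd L)
    (ht : Odd t) (y : Fin d → ZMod M) :
    ((polys s univ).filter fun X => IsConn X ∧ (blocks s X).card ≤ 2 ^ d ∧
        ¬ Disjoint X (blockOf (L * s) y)).card ≤ L ^ d * 2 ^ ((2 ^ (d + 1) + 2) ^ d) := by
  have hM' : M = s * (L * t) := by rw [hM]; ring
  -- index by the `k`-block of a meeting point
  have hsub : ((polys s univ).filter fun X => IsConn X ∧ (blocks s X).card ≤ 2 ^ d ∧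
      ¬ Disjoint X (blockOf (L * s) y)) ⊆ (blocks s (blockOf (L * s) y)).biUnion fun B =>
        (polys s univ).filter fun X => IsConn X ∧ (blocks s X).card ≤ 2 ^ d ∧ B ⊆ X := by
    intro X hX
    obtain ⟨hXp, hc, hm, hd⟩ := mem_filter.1 hX
    obtain ⟨x, hxX, hxB⟩ := not_disjoint_iff.1 hd
    exact mem_biUnion.2 ⟨blockOf s x, mem_blocks.2 ⟨x, hxB, rfl⟩,
      mem_filter.2 ⟨hXp, hc, hm, (mem_polys.1 hXp).2 x hxX⟩⟩
  refine (card_le_card hsub).trans (card_biUnion_le.trans ?_)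
  refine (sum_le_sum (g := fun _ => 2 ^ ((2 ^ (d + 1) + 2) ^ d)) fun B hB => ?_).trans (le_of_eq ?_)
  · obtain ⟨x, -, rfl⟩ := mem_blocks.1 hB
    refine (card_le_card fun X hX => ?_).trans (card_small_containing_le hM' hs (hL.mul ht) x)
    obtain ⟨hXp, hc, hm, hBX⟩ := mem_filter.1 hX
    exact mem_filter.2 ⟨hXp, hc, hm, hBX (mem_blockOf_self s x)⟩
  · rw [sum_const, smul_eq_mul, card_blocks_blockOf_mul hM hs hL ht y]

/-! ## Animal sums: [Bry09] Lemma 6.16, [ABKM19] Lemma A.2 -/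

/-- **`Σ_{X ⊆ U, X̄ = U} κ^{|X|_k} ≤ (2^{L^d} κ)^{|U|_{k+1}}`** for `0 ≤ κ ≤ 1` and a `(k+1)`-polymer
`U`: each term is `≤ κ^{|U|_{k+1}}` (`|X̄|_{k+1} ≤ |X|_k`) and there are at most
`2^{|𝓑_k(U)|} = 2^{L^d|U|_{k+1}}` terms. [cite: Brydges2009, Lemma 6.16] -/
theorem sum_pow_card_blocks_le {s L t : ℕ} (hM : M = L * s * t) (hs : Odd s) (hL : Odd L) (ht : Odd t)
    {U : Finset (Fin d → ZMod M)} (hU : IsPolymer (L * s) U) {κ : ℝ} (h0 : 0 ≤ κ) (h1 : κ ≤ 1) :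
    ∑ X ∈ (polys s U).filter (fun X => closure (L * s) X = U), κ ^ (blocks s X).card
      ≤ ((2 : ℝ) ^ (L ^ d) * κ) ^ (blocks (L * s) U).card := by
  set n := (blocks (L * s) U).card
  have hterm : ∀ X ∈ (polys s U).filter (fun X => closure (L * s) X = U),
      κ ^ (blocks s X).card ≤ κ ^ n := by
    intro X hX
    have hcl := (mem_filter.1 hX).2
    have hle : n ≤ (blocks s X).card := by
      have := card_blocks_closure_le hs hL X
      rwa [hcl] at this
    exact pow_le_pow_of_le_one h0 h1 hle
  refine (sum_le_card_nsmul _ _ _ hterm).trans ?_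
  rw [nsmul_eq_mul, mul_pow, ← pow_mul]
  refine mul_le_mul_of_nonneg_right ?_ (pow_nonneg h0 n)
  have hc : ((polys s U).filter (fun X => closure (L * s) X = U)).card ≤ 2 ^ (L ^ d * n) := by
    refine (card_le_card (filter_subset _ _)).trans ((card_polys_le_two_pow s U).trans ?_)
    rw [card_blocks_eq_mul hM hs hL ht hU]
  exact_mod_cast hc

/-- **[ABKM19] Lemma A.2 / [Bry09] Lemma 6.16**: for `κ ≤ 2^{−L^d}` the animal sum is at most `1`.
[cite: Brydges2009, Lemma 6.16] -/
theorem sum_pow_card_blocks_le_one {s L t : ℕ} (hM : M = L * s * t) (hs : Odd s) (hL : Odd L)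
    (ht : Odd t) {U : Finset (Fin d → ZMod M)} (hU : IsPolymer (L * s) U) {κ : ℝ} (h0 : 0 ≤ κ)
    (hκ : (2 : ℝ) ^ (L ^ d) * κ ≤ 1) :
    ∑ X ∈ (polys s U).filter (fun X => closure (L * s) X = U), κ ^ (blocks s X).card ≤ 1 := by
  have h1 : κ ≤ 1 := by
    have h2 : (1 : ℝ) ≤ 2 ^ (L ^ d) := one_le_pow₀ (by norm_num)
    nlinarith
  exact (sum_pow_card_blocks_le hM hs hL ht hU h0 h1).trans
    (pow_le_one₀ (mul_nonneg (pow_nonneg (by norm_num) _) h0) hκ)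

/-! ## The gain form used in (10.8) -/

/-- One term of (10.8): if `η |U|_{k+1} ≤ |X|_k` and `A ≥ 1` then
`A^{|U|_{k+1}} / A^{|X|_k} ≤ A^{−(η−1)|U|_{k+1}}`. [cite: AdamsBuchholzKoteckyMuller2019, proof of Lemma 10.2 (10.8)] -/
theorem gain_term_le {A η : ℝ} (hA : 1 ≤ A) {n m : ℕ} (hgain : η * n ≤ m) :
    A ^ n * (A ^ m)⁻¹ ≤ A ^ (-(η - 1) * n : ℝ) := by
  have hA0 : 0 < A := by linarith
  have h1 : A ^ (η * n : ℝ) ≤ (A ^ m : ℝ) := by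
    rw [← Real.rpow_natCast A m]
    exact Real.rpow_le_rpow_of_exponent_le hA hgain
  have h2 : 0 < A ^ (η * n : ℝ) := Real.rpow_pos_of_pos hA0 _
  calc A ^ n * (A ^ m)⁻¹ ≤ A ^ n * (A ^ (η * n : ℝ))⁻¹ := by
        refine mul_le_mul_of_nonneg_left ?_ (pow_nonneg hA0.le n)
        exact inv_anti₀ h2 h1
    _ = A ^ (-(η - 1) * n : ℝ) := by
        rw [← Real.rpow_natCast A n, ← Real.rpow_neg hA0.le, ← Real.rpow_add hA0]
        congr 1; ring

/-- The per-polymer form of the gain used in (10.8): if `η |U|_{k+1} ≤ |X|_k`, `η > 0`, `A ≥ 1` then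
`A^{|U|_{k+1}} / A^{|X|_k} ≤ (A^{−(1 − 1/η)})^{|X|_k}`. [cite: AdamsBuchholzKoteckyMuller2019, proof of Lemma 10.2 (10.8)] -/
theorem gain_term_le_pow {A η : ℝ} (hA : 1 ≤ A) (hη : 0 < η) {n m : ℕ} (hgain : η * n ≤ m) :
    A ^ n * (A ^ m)⁻¹ ≤ (A ^ (-(1 - η⁻¹) : ℝ)) ^ m := by
  have hA0 : 0 < A := by linarith
  have h1 : (A ^ n : ℝ) ≤ A ^ ((m : ℝ) / η) := by
    rw [← Real.rpow_natCast A n]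
    refine Real.rpow_le_rpow_of_exponent_le hA ?_
    rw [le_div_iff₀ hη]; linarith
  calc A ^ n * (A ^ m)⁻¹ ≤ A ^ ((m : ℝ) / η) * (A ^ m)⁻¹ :=
        mul_le_mul_of_nonneg_right h1 (inv_nonneg.2 (pow_nonneg hA0.le m))
    _ = (A ^ (-(1 - η⁻¹) : ℝ)) ^ m := by
        rw [← Real.rpow_natCast A m, ← Real.rpow_neg hA0.le, ← Real.rpow_add hA0,
          ← Real.rpow_mul_natCast hA0.le]
        congr 1; rw [div_eq_mul_inv]; ring

/-- **The large-polymer sum of (10.8)**: for a family `T` of `k`-polymers `X ⊆ U` (a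
`(k+1)`-polymer) with the gain `η |U|_{k+1} ≤ |X|_k` on `T` and `A ≥ 1`,
`Σ_{X ∈ T} A^{|U|_{k+1}} A^{−|X|_k} ≤ (2^{L^d})^{|U|_{k+1}} · A^{−(η−1)|U|_{k+1}}`
(so `≤ 2^{L^d} A^{−(η−1)}`-small once `|U|_{k+1} ≥ 1` and `A^{η−1} ≥ 2^{L^d}`).
[cite: AdamsBuchholzKoteckyMuller2019, proof of Lemma 10.2 (10.8)] -/
theorem sum_gain_le {s L t : ℕ} (hM : M = L * s * t) (hs : Odd s) (hL : Odd L) (ht : Odd t)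
    {U : Finset (Fin d → ZMod M)} (hU : IsPolymer (L * s) U) {A η : ℝ} (hA : 1 ≤ A)
    {T : Finset (Finset (Fin d → ZMod M))} (hT : T ⊆ polys s U)
    (hgain : ∀ X ∈ T, η * (blocks (L * s) U).card ≤ (blocks s X).card) :
    ∑ X ∈ T, A ^ (blocks (L * s) U).card * (A ^ (blocks s X).card)⁻¹
      ≤ ((2 : ℝ) ^ (L ^ d)) ^ (blocks (L * s) U).card * A ^ (-(η - 1) * (blocks (L * s) U).card : ℝ) := by
  set n := (blocks (L * s) U).card
  have hA0 : 0 < A := by linarith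
  refine (sum_le_card_nsmul _ _ _ fun X hX => gain_term_le hA (hgain X hX)).trans ?_
  rw [nsmul_eq_mul, ← pow_mul]
  refine mul_le_mul_of_nonneg_right ?_ (Real.rpow_nonneg hA0.le _)
  have hc : T.card ≤ 2 ^ (L ^ d * n) := by
    refine (card_le_card hT).trans ((card_polys_le_two_pow s U).trans ?_)
    rw [card_blocks_eq_mul hM hs hL ht hU]
  exact_mod_cast hc

end Literature.MathematicalPhysics.StatisticalMechanics.TorusPolymer

end
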